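import Summits.QuantumFields.BalabanUV.Beta.D1BFx.WilsonLinearGaugeTorus
import Summits.QuantumFields.BalabanUV.Beta.D1BFx.WilsonLinearGaugeLattice
import Summits.QuantumFields.BalabanUV.Beta.D1BFx.WilsonStencilRealised

/-!
# `BalabanUV.Beta.D1BFx.WilsonLinearGauge` — road «BF-x» for binder row D1, letter «LG-E′» part 3: an3's LINEAR-GAUGE LETTER FOR THE
# ROAD'S (V-Δ) FIELD-BLOCK STENCIL `wilsonA` ON `ℤ⁴`: `Σ_u wilsonA 3 κ u x z (inl α) (inl β) = −½·(x_κ − z_κ)·elCol β z α x`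

HONEST DEPENDENCY (page 1, mandatory): continuum YM on T⁴ ⇐ BetaPertH ∧ nine spine estimates (0/9 proved); BetaPertH ⇐ (D1) ∧ (D4) ∧
CAP+tail; G-an2-4 gates asym, D1 and NE2/3/4.  HONEST FRAMING (cell contract, verbatim): «discharging `BetaPertH` makes Bałaban's UV
stability UNCONDITIONAL — a real constructive-QFT result; it is NOT the continuum limit and NOT the Clay problem.»  THIS MODULE DISCHARGES
NOTHING of the wall: [folklore] bookkeeping BY NAME over parts 1–2 (`WilsonLinearGaugeTorus.sum_wilsonVertex₁_one_antisymm` on the torus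
`(ZMod n)⁴`, `WilsonLinearGaugeLattice.curv_bondDelta_sub_eq_elCol`, `sum_real_apply`), an3's realisation dictionary
(`WilsonStencilZ4.real_wilsonStn`, `WilsonStencilRealised.wEntry_eq_realK ∕ realK_eq_real ∕ SbE_eq_realK`) and an2's offset alphabet
(`PlaquetteStencilData.wilsonVertex₁_apply_ne_zero`), kernel-checked; no `Prop` minted, no definition, nothing printed asserted, 0 sorry,
0 cited facts.  0 wall binders (root-level hW ∕ hR-sockets ∕ hSX-socket ∕ D1Tel ∕ D1Rep — 0 discharged); (K) NOT closed; NOT D1, NOT `BetaPertH`,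
NOT continuum, NOT Clay.  It TYPES an3's letter «LG-E′» (owner FINDING F-g9-1 (3)); it does NOT prove WARD-L ∕ (III), bounds no needle row,
and touches no END statement.

ABSOLUTE RULE (cell charter, verbatim): «No internally-minted statement may enter as a cited fact. Every hypothesis is either kernel-proved in
this package or a verbatim quotation of a PUBLISHED theorem with page reference. The manuscript(s) under audit are NOT citable for their own
disputed steps — they are the thing under adjudication; programme-internal (2001/route/tribunal) claims are never citable.»

WHAT (owner ruling ρ-g9-9; an3 LETTER «LG-E′» (B1) = owner (ρ-g9-8)(b), verbatim): for all `κ″ (x z : Pt) (α β : Fin 4)`,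
`Σ_{u′} wilsonA 3 κ″ u′ x z (Sum.inl α) (Sum.inl β) = −(1/2)·((x κ″ : ℝ) − (z κ″ : ℝ))·elCol β z α x`.
* §1 THE TRANSFER TORUS → `ℤ⁴`.  The reduction `π_n : ℤ⁴ → (ZMod n)⁴` is additive and injective on every box of radius `< n`
  (`red_eq_iff`); composed with an2's frame it is a frame of the torus whose `lift` is `π_n` itself (part 2), so an3's one-bond list
  `wilsonStn κ 1` realises an2's `wEntry` on `ℤ⁴` (`wEntry_eq_realK`) AND an3's `wilsonVertex₁` on the torus (`real_wilsonStn`); the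
  zero-momentum columns of the two realisations agree once `n` exceeds the finitely many separations involved (`sum_wEntry_eq_listSum`,
  `sum_wilsonVertex₁_torus_eq_listSum`, `listSum_red_eq`), and so do the plaquette incidences (`lcurl_bondLetter_red`).
* §2 **`sum_wilsonA_inl_inl`** (Finset form, any window `U` holding the support), **`tsum_wilsonA_inl_inl`** (an3's display verbatim),
  `hasSum_wilsonA_inl_inl`, and the REALISED form **`tsum_realK_sbEStn`** (`Σ_u realK u u (sbEStn κ) x z α β = −½·(x_κ − z_κ)·elCol β z α x`,
  via `SbE_eq_realK`); support bookkeeping `sub_mem_box1_of_wilsonA_ne_zero` (an2's offset alphabet ⊆ `box1`).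
Unit `b2b-balaban-beta-d1-formalise-leaf-04` (gen 8); `LEAVES-BFx.md` row «LG-E′».
-/

open Finset
open scoped BigOperators
open Literature.MathematicalPhysics.QuantumFieldTheory.Balaban1983to89
open Literature.MathematicalPhysics.QuantumFieldTheory.Balaban1983to89.Beta
open DyadicShell (Pt)
open GradedBubbles (LP Stn)
open StepJetData (wEntry wilsonA)
open PlaquetteVertex (lcurl bondLetter)
open PlaquetteStencil (wilsonVertex₁)
open PlaquetteStencilData (IsOffset wilsonVertex₁_apply_ne_zero)
open BalabanStepJets (bondDelta elCol box1 mem_box1)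
open Summit.QuantumFields.BalabanUV.Beta.GradedStencilDictionary (lift real)
open Summit.QuantumFields.BalabanUV.Beta.WilsonStencilZ4 (wilsonStn real_wilsonStn)
open Summit.QuantumFields.BalabanUV.Beta.D1BFx.StencilRealisation (realK)
open Summit.QuantumFields.BalabanUV.Beta.D1BFx.WilsonStencilRealised (wEntry_eq_realK realK_eq_real lift_unitVec_eq sbEStn SbE_eq_realK)
open Summit.QuantumFields.BalabanUV.Beta.D1BFx.WilsonLinearGaugeTorus (sum_wilsonVertex₁_one_antisymm)
open Summit.QuantumFields.BalabanUV.Beta.D1BFx.WilsonLinearGaugeLattice (curv_bondDelta_sub_eq_elCol sum_real_apply lift_comp_unitVec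
  exists_abs_le_of_list)

namespace Summit.QuantumFields.BalabanUV.Beta.D1BFx.WilsonLinearGauge

/-! ## §1 The transfer torus → `ℤ⁴` -/

section Transfer

/-- [folklore] an2's two `ℤ⁴` frames agree: `B6BondElimination.unitVec = AffineAveraging.unitVec` (both are `e_μ`). -/
theorem unitVec_eq (μ : Fin 4) : B6BondElimination.unitVec (d := 4) μ = AffineAveraging.unitVec μ := by
  funext i
  rw [AffineAveraging.unitVec_apply]
  rfl

/-- [folklore] **THE REDUCTION `ℤ⁴ → (ZMod n)⁴` IS INJECTIVE ON THE BOX OF RADIUS `< n`**: for `|v_i| < n` (all `i`),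
`π_n v = π_n w ↔ v = w` whenever `|v_i − w_i| < n`. -/
theorem red_eq_iff {n : ℕ} [NeZero n] (v w : Pt) (h : ∀ i, |(v - w) i| < n) :
    ((Int.castAddHom (ZMod n)).compLeft (Fin 4)) v = ((Int.castAddHom (ZMod n)).compLeft (Fin 4)) w ↔ v = w := by
  constructor
  · intro hvw
    have h0 : ((Int.castAddHom (ZMod n)).compLeft (Fin 4)) (v - w) = 0 := by rw [map_sub, hvw, sub_self]
    have h1 : v - w = 0 := by
      funext i
      have hi := congr_fun h0 i
      rw [AddMonoidHom.compLeft_apply, Function.comp_apply, Int.coe_castAddHom, Pi.zero_apply,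
        ZMod.intCast_zmod_eq_zero_iff_dvd] at hi
      exact Int.eq_zero_of_abs_lt_dvd hi (h i)
    exact sub_eq_zero.mp h1
  · intro hvw
    rw [hvw]

variable {I : Type*}

/-- [folklore] **THE ZERO-MOMENTUM COLUMN OF an2's `wEntry` ON `ℤ⁴` IS THE COLUMN OF an3's LIST** (any window `U` holding the row sites):
`Σ_{u ∈ U} wEntry 3 κ u x z α β = Σ_{p ∈ wilsonStn κ 1} [z − x = p.y − p.x]·p.m_{αβ}`. -/
theorem sum_wEntry_eq_listSum (κ : Fin 4) (x z : Pt) (α β : Fin 4) (U : Finset Pt)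
    (hU : ∀ p ∈ wilsonStn κ (1 : Matrix Unit Unit ℝ), x - p.x ∈ U) :
    ∑ u ∈ U, wEntry 3 κ u x z α β =
      ((wilsonStn κ (1 : Matrix Unit Unit ℝ)).map fun p => if z - x = p.y - p.x then p.m ((), α) ((), β) else 0).sum := by
  simp only [wEntry_eq_realK, realK_eq_real]
  rw [sum_real_apply (B6BondElimination.unitVec (d := 4)) _ x z ((), α) ((), β) U (fun p hp => by rw [lift_unitVec_eq]; exact hU p hp)]
  simp only [lift_unitVec_eq]

/-- [folklore] **THE ZERO-MOMENTUM COLUMN OF an3's `wilsonVertex₁` ON THE TORUS IS THE COLUMN OF THE SAME LIST, READ MODULO `n`**. -/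
theorem sum_wilsonVertex₁_torus_eq_listSum {n : ℕ} [NeZero n] (κ : Fin 4) (x z : Pt) (α β : Fin 4) :
    ∑ u : Fin 4 → ZMod n, wilsonVertex₁ (fun i => ((Int.castAddHom (ZMod n)).compLeft (Fin 4)) (B6BondElimination.unitVec (d := 4) i))
        u κ (1 : Matrix Unit Unit ℝ) (((Int.castAddHom (ZMod n)).compLeft (Fin 4)) x, ((), α))
        (((Int.castAddHom (ZMod n)).compLeft (Fin 4)) z, ((), β)) =
      ((wilsonStn κ (1 : Matrix Unit Unit ℝ)).map fun p =>
        if ((Int.castAddHom (ZMod n)).compLeft (Fin 4)) z - ((Int.castAddHom (ZMod n)).compLeft (Fin 4)) x =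
          ((Int.castAddHom (ZMod n)).compLeft (Fin 4)) p.y - ((Int.castAddHom (ZMod n)).compLeft (Fin 4)) p.x
        then p.m ((), α) ((), β) else 0).sum := by
  simp only [← real_wilsonStn]
  rw [sum_real_apply _ _ _ _ ((), α) ((), β) Finset.univ (fun p _ => Finset.mem_univ _)]
  simp only [lift_comp_unitVec]

/-- [folklore] **THE TWO COLUMNS AGREE** once `n` exceeds every separation `z − x − (p.y − p.x)` of the list. -/
theorem listSum_red_eq {n : ℕ} [NeZero n] (V : Stn I) (x z : Pt) (a b : I)
    (hn : ∀ p ∈ V, ∀ i, |(z - x - (p.y - p.x)) i| < n) :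
    (V.map fun p =>
        if ((Int.castAddHom (ZMod n)).compLeft (Fin 4)) z - ((Int.castAddHom (ZMod n)).compLeft (Fin 4)) x =
          ((Int.castAddHom (ZMod n)).compLeft (Fin 4)) p.y - ((Int.castAddHom (ZMod n)).compLeft (Fin 4)) p.x
        then p.m a b else 0).sum =
      (V.map fun p => if z - x = p.y - p.x then p.m a b else 0).sum := by
  congr 1
  refine List.map_congr_left fun p hp => ?_
  have h : (((Int.castAddHom (ZMod n)).compLeft (Fin 4)) z - ((Int.castAddHom (ZMod n)).compLeft (Fin 4)) x =
      ((Int.castAddHom (ZMod n)).compLeft (Fin 4)) p.y - ((Int.castAddHom (ZMod n)).compLeft (Fin 4)) p.x) ↔ (z - x = p.y - p.x) := by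
    rw [← map_sub, ← map_sub]
    exact red_eq_iff (z - x) (p.y - p.x) (hn p hp)
  simp only [h]

/-- [folklore] **THE PLAQUETTE INCIDENCE TRANSFERS**: for `n > |y_i − x_i| + 2` (all `i`), an3's torus incidence
`lcurl e′ (bondLetter (π x) α 1) (π y − e′ κ) κ β` is an2's `curv (e_{(α,x)})_{κβ}(y − e_κ)` on `ℤ⁴`. -/
theorem lcurl_bondLetter_red {n : ℕ} [NeZero n] (x y : Pt) (κ α β : Fin 4) (hn : ∀ i, |(y - x) i| + 2 < n) :
    lcurl (fun i => ((Int.castAddHom (ZMod n)).compLeft (Fin 4)) (B6BondElimination.unitVec (d := 4) i))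
        (bondLetter (((Int.castAddHom (ZMod n)).compLeft (Fin 4)) x) α (1 : ℝ))
        (((Int.castAddHom (ZMod n)).compLeft (Fin 4)) y - ((Int.castAddHom (ZMod n)).compLeft (Fin 4)) (B6BondElimination.unitVec (d := 4) κ))
        κ β =
      AffineAveraging.curv (bondDelta α x) κ β (y - AffineAveraging.unitVec κ) := by
  set π := (Int.castAddHom (ZMod n)).compLeft (Fin 4) with hπ
  have hu : ∀ (μ : Fin 4) (i : Fin 4), |AffineAveraging.unitVec (d := 4) μ i| ≤ 1 := by
    intro μ i
    rw [AffineAveraging.unitVec_apply]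
    split_ifs <;> simp
  have key : ∀ s : Pt, (∀ i, |(s - x) i| < n) → ((π s = π x) ↔ (s = x)) := fun s hs => red_eq_iff s x hs
  have b1 : ∀ i, |(y - AffineAveraging.unitVec κ + AffineAveraging.unitVec κ - x) i| < n := by
    intro i
    rw [sub_add_cancel]
    linarith [hn i, abs_nonneg ((y - x) i)]
  have b2 : ∀ i, |(y - AffineAveraging.unitVec κ - x) i| < n := by
    intro i
    have e : (y - AffineAveraging.unitVec κ - x) i = (y - x) i - AffineAveraging.unitVec κ i := by
      simp only [Pi.sub_apply]; ring
    rw [e]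
    linarith [hn i, abs_sub ((y - x) i) (AffineAveraging.unitVec κ i), hu κ i]
  have b3 : ∀ i, |(y - AffineAveraging.unitVec κ + AffineAveraging.unitVec β - x) i| < n := by
    intro i
    have e : (y - AffineAveraging.unitVec κ + AffineAveraging.unitVec β - x) i =
        (y - x) i - AffineAveraging.unitVec κ i + AffineAveraging.unitVec β i := by
      simp only [Pi.sub_apply, Pi.add_apply]; ring
    rw [e]
    linarith [hn i, abs_add_le ((y - x) i - AffineAveraging.unitVec κ i) (AffineAveraging.unitVec β i),
      abs_sub ((y - x) i) (AffineAveraging.unitVec κ i), hu κ i, hu β i]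
  simp only [lcurl, bondLetter, AffineAveraging.curv, bondDelta, unitVec_eq, ← map_sub, ← map_add, key _ b1, key _ b2, key _ b3]
  have c1 : (y - AffineAveraging.unitVec κ + AffineAveraging.unitVec κ = x) ↔ (x = y - AffineAveraging.unitVec κ + AffineAveraging.unitVec κ) :=
    eq_comm
  have c2 : (y - AffineAveraging.unitVec κ = x) ↔ (x = y - AffineAveraging.unitVec κ) := eq_comm
  have c3 : (y - AffineAveraging.unitVec κ + AffineAveraging.unitVec β = x) ↔ (x = y - AffineAveraging.unitVec κ + AffineAveraging.unitVec β) :=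
    eq_comm
  have c4 : (β = α) ↔ (α = β) := eq_comm
  have c5 : (κ = α) ↔ (α = κ) := eq_comm
  simp only [c1, c2, c3, c4, c5]
  have swap : ∀ (P Q : Prop) [Decidable P] [Decidable Q], (if P ∧ Q then (1 : ℝ) else 0) = if Q ∧ P then 1 else 0 := by
    intro P Q _ _
    by_cases hP : P <;> by_cases hQ : Q <;> simp [hP, hQ]
  rw [swap (x = _) (α = β), swap (x = _) (α = β), swap (x = _) (α = κ), swap (x = _) (α = κ)]
  ring

/-- [folklore] A window size past all the separations in play exists. -/
theorem exists_window (V : Stn I) (x z : Pt) :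
    ∃ n : ℕ, 0 < n ∧ (∀ p ∈ V, ∀ i, |(z - x - (p.y - p.x)) i| < n) ∧ (∀ p ∈ V, ∀ i, |(x - z - (p.y - p.x)) i| < n) ∧
      (∀ i, |(z - x) i| + 2 < n) ∧ (∀ i, |(x - z) i| + 2 < n) := by
  obtain ⟨B, hB⟩ := exists_abs_le_of_list V (fun p => p.y - p.x)
  refine ⟨B + (∑ i, |(z - x) i|).toNat + 3, by omega, ?_, ?_, ?_, ?_⟩
  all_goals first
    | intro p hp i
    | intro i
  all_goals
    have hs : |(z - x) i| ≤ ∑ j, |(z - x) j| := Finset.single_le_sum (f := fun j => |(z - x) j|) (fun j _ => abs_nonneg _) (Finset.mem_univ i)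
    have ht : (∑ j, |(z - x) j| : ℤ) = ((∑ j, |(z - x) j|).toNat : ℤ) :=
      (Int.toNat_of_nonneg (Finset.sum_nonneg fun j _ => abs_nonneg _)).symm
    have hxz : |(x - z) i| = |(z - x) i| := by rw [Pi.sub_apply, Pi.sub_apply, abs_sub_comm]
    push_cast
  · have h1 := hB p hp i
    have h2 : |(z - x - (p.y - p.x)) i| ≤ |(z - x) i| + |(p.y - p.x) i| := by rw [Pi.sub_apply]; exact abs_sub _ _
    linarith
  · have h1 := hB p hp i
    have h2 : |(x - z - (p.y - p.x)) i| ≤ |(x - z) i| + |(p.y - p.x) i| := by rw [Pi.sub_apply]; exact abs_sub _ _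
    linarith
  · have hB0 : (0 : ℤ) ≤ B := Int.natCast_nonneg B
    linarith
  · have hB0 : (0 : ℤ) ≤ B := Int.natCast_nonneg B
    linarith

end Transfer

/-! ## §2 an3's letter «LG-E′» on `ℤ⁴` -/

section Letter

/-- [folklore] The field-block entry of `wilsonA` is half the antisymmetrised `wEntry`. -/
theorem wilsonA_inl_inl (κ : Fin 4) (u x z : Pt) (α β : Fin 4) :
    wilsonA 3 κ u x z (Sum.inl α) (Sum.inl β) = (1 / 2 : ℝ) * (wEntry 3 κ u x z α β - wEntry 3 κ u z x β α) := rfl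

/-- [folklore] an2's offset alphabet lies in the unit box. -/
theorem mem_box1_of_isOffset {κ : Fin 4} {o : Pt} (h : IsOffset (B6BondElimination.unitVec (d := 4)) κ o) : o ∈ box1 4 := by
  rw [mem_box1]
  intro i
  rcases h with h | h | ⟨μ, h | h | h⟩ <;> subst h <;>
    simp only [Pi.zero_apply, Pi.neg_apply, Pi.sub_apply, B6BondElimination.unitVec] <;>
    first | (split_ifs <;> norm_num) | norm_num

/-- [folklore] **SUPPORT**: a non-zero `wEntry 3 κ u x z α β` has both legs within the unit box of the base site. -/
theorem sub_mem_box1_of_wEntry_ne_zero {κ : Fin 4} {u x z : Pt} {α β : Fin 4} (h : wEntry 3 κ u x z α β ≠ 0) :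
    x - u ∈ box1 4 ∧ z - u ∈ box1 4 := by
  obtain ⟨⟨o, ho, hx⟩, ⟨o', ho', hz⟩⟩ := wilsonVertex₁_apply_ne_zero (B6BondElimination.unitVec (d := 4)) u κ (1 : Matrix Unit Unit ℝ) h
  refine ⟨?_, ?_⟩
  · have : x - u = o := by rw [show x = u + o from hx]; abel
    rw [this]; exact mem_box1_of_isOffset ho
  · have : z - u = o' := by rw [show z = u + o' from hz]; abel
    rw [this]; exact mem_box1_of_isOffset ho'

/-- [folklore] **SUPPORT OF THE LETTER'S SUMMAND**: `wilsonA 3 κ u x z (inl α) (inl β) ≠ 0 ⇒ x − u ∈ box1`. -/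
theorem sub_mem_box1_of_wilsonA_ne_zero {κ : Fin 4} {u x z : Pt} {α β : Fin 4} (h : wilsonA 3 κ u x z (Sum.inl α) (Sum.inl β) ≠ 0) :
    x - u ∈ box1 4 := by
  rw [wilsonA_inl_inl] at h
  by_cases h1 : wEntry 3 κ u x z α β = 0
  · by_cases h2 : wEntry 3 κ u z x β α = 0
    · exact absurd (by rw [h1, h2]; ring) h
    · exact (sub_mem_box1_of_wEntry_ne_zero h2).2
  · exact (sub_mem_box1_of_wEntry_ne_zero h1).1

/-- [folklore] **an3's LETTER «LG-E′», WINDOW FORM**: for every finite window `U ⊆ ℤ⁴` holding the support of the summand,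
`Σ_{u ∈ U} wilsonA 3 κ u x z (inl α) (inl β) = −½·(x_κ − z_κ)·elCol β z α x`. -/
theorem sum_wilsonA_inl_inl (κ : Fin 4) (x z : Pt) (α β : Fin 4) (U : Finset Pt)
    (hU : ∀ u, wilsonA 3 κ u x z (Sum.inl α) (Sum.inl β) ≠ 0 → u ∈ U) :
    ∑ u ∈ U, wilsonA 3 κ u x z (Sum.inl α) (Sum.inl β) = -(1 / 2 : ℝ) * (((x κ : ℤ) : ℝ) - ((z κ : ℤ) : ℝ)) * elCol β z α x := by
  classical
  set V : Stn (Unit × Fin 4) := wilsonStn κ (1 : Matrix Unit Unit ℝ) with hV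
  -- enlarge the window by the row sites of the list (the summand vanishes there anyway)
  set U' : Finset Pt := U ∪ ((V.map fun p => x - p.x) ++ (V.map fun p => z - p.x)).toFinset with hU'
  have hsub : U ⊆ U' := Finset.subset_union_left
  have hvan : ∀ u ∈ U', u ∉ U → wilsonA 3 κ u x z (Sum.inl α) (Sum.inl β) = 0 := fun u _ hu => by
    by_contra hne; exact hu (hU u hne)
  rw [Finset.sum_subset hsub hvan]
  have hx : ∀ p ∈ V, x - p.x ∈ U' := fun p hp =>
    Finset.mem_union_right _ (List.mem_toFinset.mpr (List.mem_append_left _ (List.mem_map.mpr ⟨p, hp, rfl⟩)))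
  have hz : ∀ p ∈ V, z - p.x ∈ U' := fun p hp =>
    Finset.mem_union_right _ (List.mem_toFinset.mpr (List.mem_append_right _ (List.mem_map.mpr ⟨p, hp, rfl⟩)))
  simp only [wilsonA_inl_inl]
  rw [← Finset.mul_sum, Finset.sum_sub_distrib]
  rw [sum_wEntry_eq_listSum κ x z α β U' hx, sum_wEntry_eq_listSum κ z x β α U' hz]
  -- the torus
  obtain ⟨n, hn0, hn1, hn2, hn3, hn4⟩ := exists_window V x z
  haveI : NeZero n := ⟨hn0.ne'⟩
  have T := sum_wilsonVertex₁_one_antisymm (Λ := Fin 4 → ZMod n)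
    (fun i => ((Int.castAddHom (ZMod n)).compLeft (Fin 4)) (B6BondElimination.unitVec (d := 4) i)) κ
    (((Int.castAddHom (ZMod n)).compLeft (Fin 4)) x) (((Int.castAddHom (ZMod n)).compLeft (Fin 4)) z) α β
  rw [Finset.sum_sub_distrib, sum_wilsonVertex₁_torus_eq_listSum, sum_wilsonVertex₁_torus_eq_listSum, listSum_red_eq V x z _ _ hn1,
    listSum_red_eq V z x _ _ hn2, lcurl_bondLetter_red x z κ α β hn3, lcurl_bondLetter_red z x κ β α hn4,
    curv_bondDelta_sub_eq_elCol] at T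
  rw [← hV, T]
  ring

/-- [folklore] **an3's LETTER «LG-E′» (B1), VERBATIM** (owner ruling (ρ-g9-8)(b); the physical, antisymmetrised (V-Δ) field block passes P2′
with the single constant `−½`): for all `κ (x z : Pt) (α β : Fin 4)`,
`Σ'_{u} wilsonA 3 κ u x z (Sum.inl α) (Sum.inl β) = −(1/2)·((x κ : ℝ) − (z κ : ℝ))·elCol β z α x`
(`elCol β z α x` = the entry `((α,x),(β,z))` of an2's flat Wilson Hessian `E″(1) = curvAdj ∘ curv`). -/
theorem tsum_wilsonA_inl_inl (κ : Fin 4) (x z : Pt) (α β : Fin 4) :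
    ∑' u : Pt, wilsonA 3 κ u x z (Sum.inl α) (Sum.inl β) = -(1 / 2 : ℝ) * (((x κ : ℤ) : ℝ) - ((z κ : ℤ) : ℝ)) * elCol β z α x := by
  classical
  have hs : ∀ u ∉ (box1 4).image (fun v => x - v), wilsonA 3 κ u x z (Sum.inl α) (Sum.inl β) = 0 := by
    intro u hu
    by_contra hne
    exact hu (Finset.mem_image.mpr ⟨x - u, sub_mem_box1_of_wilsonA_ne_zero hne, by abel⟩)
  rw [tsum_eq_sum (L := SummationFilter.unconditional Pt) hs]
  exact sum_wilsonA_inl_inl κ x z α β _ fun u hne => by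
    by_contra hu; exact hne (hs u hu)

/-- [folklore] The same as a `HasSum` statement. -/
theorem hasSum_wilsonA_inl_inl (κ : Fin 4) (x z : Pt) (α β : Fin 4) :
    HasSum (fun u : Pt => wilsonA 3 κ u x z (Sum.inl α) (Sum.inl β)) (-(1 / 2 : ℝ) * (((x κ : ℤ) : ℝ) - ((z κ : ℤ) : ℝ)) * elCol β z α x) := by
  classical
  have hs : ∀ u ∉ (box1 4).image (fun v => x - v), wilsonA 3 κ u x z (Sum.inl α) (Sum.inl β) = 0 := by
    intro u hu
    by_contra hne
    exact hu (Finset.mem_image.mpr ⟨x - u, sub_mem_box1_of_wilsonA_ne_zero hne, by abel⟩)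
  have h := hasSum_sum_of_ne_finset_zero (L := SummationFilter.unconditional Pt) hs
  rwa [sum_wilsonA_inl_inl κ x z α β _ fun u hne => by by_contra hu; exact hne (hs u hu)] at h

/-- [folklore] **THE REALISED FORM** (road currency, `WilsonStencilRealised.SbE_eq_realK`): the zero-momentum column of the E-sector list is
`Σ'_{u} realK u u (sbEStn κ) x z α β = −½·(x_κ − z_κ)·elCol β z α x`. -/
theorem tsum_realK_sbEStn (κ : Fin 4) (x z : Pt) (α β : Fin 4) :
    ∑' u : Pt, realK u u (sbEStn κ) x z α β = -(1 / 2 : ℝ) * (((x κ : ℤ) : ℝ) - ((z κ : ℤ) : ℝ)) * elCol β z α x := by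
  have h : ∀ u : Pt, realK u u (sbEStn κ) x z α β = wilsonA 3 κ u x z (Sum.inl α) (Sum.inl β) := by
    intro u
    rw [← SbE_eq_realK]
    rfl
  simp only [h]
  exact tsum_wilsonA_inl_inl κ x z α β

end Letter

end Summit.QuantumFields.BalabanUV.Beta.D1BFx.WilsonLinearGauge
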